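import Mathlib
import Summits.KontsevichZagierPeriods.Zeta5Search.TypeSpaceLawZeroProof
import Summits.KontsevichZagierPeriods.Zeta5Search.ConstantTermFloorWindow
import HarnessLib

/-!
# ζ(5) search — conjugation of `φ`: `‖φ_x̄ + φ_x‖ ≤ p⁻¹`, and `topLevel` of the conjugate class (tools for the origin-regime type-space law)

HONEST FRAMING: systematic search; no irrationality claim unless certified.

Cell `pub-zeta5`, prover seat p3 (gen 2), on typer g11's machinery (`TypeSpaceAggregate`, `SecondOrderPair`, `TypeSpacePoints`).
REPORT-gen2-g11 §4.1 WITHOUT the palindromic (zero-regime) hypothesis: for `M ≥ 6` even, pole classes of exponent `≥ −M`, classes of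
exponent `−M` not containing the centre, there are `p`-integral `X, Y`, weights `k_z` on the live classes (`ĝφ/4` deep, `ĝ/4` sub-deep,
`4Σ k = Res₀`) and FIRST-ORDER weights `c_x = ½ĝ_x(1 − ½pL_xφ_x)` on the deep classes with
`W/(−p)^{3−M} = A_W − pX + O(p²)`, `V/(−p)^{−M} = A_V − pY + O(p²)`, `(X, Y) ≡ Σ_z k_z P_z (mod p)`,
`A_W = Σ_{deep x} c_x(ŵ_x − ŵ_x̄)`, `A_V = Σ_{deep x} c_x(v̂_x − v̂_x̄)` (`aggregateOrigin`).  The new input relative to `aggregate₃` is the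
conjugation of `φ`: `‖φ_x̄ + φ_x‖ ≤ p⁻¹` (`phiHat_conj_add`, reflection `s ↦ b₀ − s` of the foreign factors).  In the zero regime `A = 0`
and this is `aggregate₃`; in the origin regime (`σ_x − σ_x̄ ∈ ℚ·u`) `A ∥ u`.  Nothing here bears on irrationality.
-/

noncomputable section

open Finset

namespace Summit.KontsevichZagierPeriods.Zeta5Search.SecondOrder

open Summit.KontsevichZagierPeriods.Zeta5Search.DualSeries (InBox)
open Summit.KontsevichZagierPeriods.Zeta5Search.WedgeDictionary (coeffW coeffV)
open Summit.KontsevichZagierPeriods.Zeta5Search.CasoratianValuation (InPolytope)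
open Summit.KontsevichZagierPeriods.Zeta5Search.ClusterValuation
open Summit.KontsevichZagierPeriods.Zeta5Search.PadicSeries
open Summit.KontsevichZagierPeriods.Zeta5Search.CellA (classW coeffW_eq_sum_classW padicNorm_p)
open Summit.KontsevichZagierPeriods.Zeta5Search.ResidueLaw (pointW pointV liveClasses)

variable {p : ℕ} [hp : Fact p.Prime]

/-! ## §1 Conjugation of `φ` -/

/-- An integer prime to `p`, as a rational, has norm `1`; its inverse too. -/
theorem padicNorm_inv_int_eq_one {k : ℤ} (hk : ¬ (p : ℤ) ∣ k) : padicNorm p ((k : ℚ)⁻¹) = 1 := by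
  rw [inv_eq_one_div, padicNorm.div, (padicNorm.int_eq_one_iff (p := p) k).2 hk, padicNorm.one, div_one]

/-- **Conjugation flips `φ` modulo `p`**: `‖φ_x̄ + φ_x‖ ≤ p⁻¹` for a residue `x < p ≤ b₀` (`x̄ = conjClass b p x`): the foreign factors
of `x̄` are the reflections `s ↦ b₀ − s` of those of `x` (`netExp` is reflection invariant), and `(b₀ − s) − x̄ ≡ −(s − x) (mod p)`. -/
theorem phiHat_conj_add (b : ℕ → ℤ) (h0 : 0 ≤ b 0) (hp2 : p ≠ 2) (hpn : p ≤ (b 0).toNat) {x : ℕ} (hx : x < p) :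
    padicNorm p (phiHat b p (conjClass b p x) + phiHat b p x) ≤ (p : ℚ) ^ (-(1 : ℤ)) := by
  classical
  have hp0 : (p : ℚ) ≠ 0 := Nat.cast_ne_zero.2 hp.out.ne_zero
  have hpP : Prime (p : ℤ) := Nat.prime_iff_prime_int.1 hp.out
  set N := (b 0).toNat with hN
  have hb0 : ((N : ℕ) : ℤ) = b 0 := Int.toNat_of_nonneg h0
  set xb := conjClass b p x with hxb
  have hxN : x ≤ N := by omega
  have hxble : xb ≤ N - x := by simp only [hxb, conjClass, ← hN]; exact Nat.mod_le _ _
  have hxbN : xb ≤ N := by omega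
  -- `D = N − x̄ − x` is a multiple of `p`
  obtain ⟨q, hq⟩ : ∃ q : ℤ, ((N : ℤ) - xb - x) = (p : ℤ) * q := by
    refine ⟨((N - x) / p : ℕ), ?_⟩
    have hnat : xb + p * ((N - x) / p) = N - x := by
      have h := Nat.mod_add_div (N - x) p
      simp only [hxb, conjClass, ← hN]
      exact h
    zify [hxN] at hnat
    push_cast [Nat.cast_sub hxN]
    linarith
  have hDnorm : padicNorm p (((N : ℚ) - xb - x)) ≤ (p : ℚ) ^ (-(1 : ℤ)) := by
    rw [show ((N : ℚ) - xb - x) = (((N : ℤ) - xb - x : ℤ) : ℚ) by push_cast; ring, hq]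
    push_cast
    rw [padicNorm.mul, padicNorm_p]
    calc (p : ℚ) ^ (-(1 : ℤ)) * padicNorm p (q : ℚ) ≤ (p : ℚ) ^ (-(1 : ℤ)) * 1 :=
          mul_le_mul_of_nonneg_left (padicNorm.of_int q) (zpow_p_nonneg _)
      _ = _ := mul_one _
  -- the foreign sets and the reflection between them
  set Fx := (range (N + 1)).filter (fun s => s % p ≠ x % p) with hFx
  set Fb := (range (N + 1)).filter (fun s => s % p ≠ xb % p) with hFb
  have hclass : ∀ y s, s ∈ classSet b p y ↔ s ∈ range (N + 1) ∧ s % p = y % p := fun y s => by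
    simp only [classSet, mem_filter, hN]
  have hmemF : ∀ {s}, s ∈ Fb → N - s ∈ Fx := by
    intro s hs
    obtain ⟨hsr, hsne⟩ := mem_filter.1 hs
    have hsN : s ≤ N := by have := mem_range.1 hsr; omega
    refine mem_filter.2 ⟨mem_range.2 (by omega), fun h => hsne ?_⟩
    have h1 : N - s ∈ classSet b p x := (hclass x (N - s)).2 ⟨mem_range.2 (by omega), h⟩
    exact ((hclass xb s).1 ((mem_classSet_conj_iff b hxN hsN).2 h1)).2
  have hmemF' : ∀ {t}, t ∈ Fx → N - t ∈ Fb := by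
    intro t ht
    obtain ⟨htr, htne⟩ := mem_filter.1 ht
    have htN : t ≤ N := by have := mem_range.1 htr; omega
    refine mem_filter.2 ⟨mem_range.2 (by omega), fun h => htne ?_⟩
    have h1 : N - t ∈ classSet b p xb := (hclass xb (N - t)).2 ⟨mem_range.2 (by omega), h⟩
    have h2 := (mem_classSet_conj_iff b hxN (by omega : N - t ≤ N)).1 h1
    rw [Nat.sub_sub_self htN] at h2
    exact ((hclass x t).1 h2).2
  have hreidx : ∑ s ∈ Fb, (netExp b s : ℚ) / ((s : ℚ) - xb)
      = ∑ t ∈ Fx, (netExp b t : ℚ) / (((N - t : ℕ) : ℚ) - xb) := by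
    refine Finset.sum_nbij' (fun s => N - s) (fun t => N - t) (fun s hs => hmemF hs) (fun t ht => hmemF' ht)
      (fun s hs => ?_) (fun t ht => ?_) (fun s hs => ?_)
    · have := mem_range.1 (mem_filter.1 hs).1; omega
    · have := mem_range.1 (mem_filter.1 ht).1; omega
    · have hsN : s ≤ N := by have := mem_range.1 (mem_filter.1 hs).1; omega
      have hr := netExp_reflect b h0 hsN
      rw [← hN] at hr
      rw [Nat.sub_sub_self hsN, hr]
  -- termwise pairing
  have hterm : ∀ t ∈ Fx, padicNorm p ((netExp b t : ℚ) / (((N - t : ℕ) : ℚ) - xb) + (netExp b t : ℚ) / ((t : ℚ) - x))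
      ≤ (p : ℚ) ^ (-(1 : ℤ)) := by
    intro t ht
    obtain ⟨htr, htne⟩ := mem_filter.1 ht
    have htN : t ≤ N := by have := mem_range.1 htr; omega
    have h1 : ¬ (p : ℤ) ∣ ((t : ℤ) - x) := by
      intro h
      refine htne ((Nat.modEq_iff_dvd.2 ?_ : x ≡ t [MOD p]).symm)
      simpa using h
    have h2 : ¬ (p : ℤ) ∣ ((N : ℤ) - t - xb) := by
      intro h
      refine h1 ?_
      have : ((t : ℤ) - x) = ((N : ℤ) - xb - x) - ((N : ℤ) - t - xb) := by ring
      rw [this, hq]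
      exact dvd_sub (dvd_mul_right _ _) h
    have h1q : ((t : ℚ) - x) ≠ 0 := by
      have : ((t : ℤ) - x) ≠ 0 := fun h => h1 (by rw [h]; exact dvd_zero _)
      exact_mod_cast this
    have h2q : (((N - t : ℕ) : ℚ) - xb) ≠ 0 := by
      have : ((N : ℤ) - t - xb) ≠ 0 := fun h => h2 (by rw [h]; exact dvd_zero _)
      have h' : (((N - t : ℕ) : ℚ) - xb) = (((N : ℤ) - t - xb : ℤ) : ℚ) := by push_cast [Nat.cast_sub htN]; ring
      rw [h']; exact_mod_cast this
    have e : (netExp b t : ℚ) / (((N - t : ℕ) : ℚ) - xb) + (netExp b t : ℚ) / ((t : ℚ) - x)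
        = (netExp b t : ℚ) * ((N : ℚ) - xb - x) * ((((N : ℤ) - t - xb : ℤ) : ℚ))⁻¹ * ((((t : ℤ) - x : ℤ) : ℚ))⁻¹ := by
      have h' : (((N - t : ℕ) : ℚ) - xb) = (((N : ℤ) - t - xb : ℤ) : ℚ) := by push_cast [Nat.cast_sub htN]; ring
      rw [h'] at h2q ⊢
      have h1' : ((((t : ℤ) - x : ℤ)) : ℚ) ≠ 0 := by push_cast; exact h1q
      field_simp
      push_cast
      ring
    rw [e, padicNorm.mul, padicNorm.mul, padicNorm.mul, padicNorm_inv_int_eq_one h2, padicNorm_inv_int_eq_one h1, mul_one,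
      mul_one]
    calc padicNorm p (netExp b t : ℚ) * padicNorm p ((N : ℚ) - xb - x) ≤ 1 * (p : ℚ) ^ (-(1 : ℤ)) :=
          mul_le_mul (padicNorm.of_int _) hDnorm (padicNorm.nonneg _) zero_le_one
      _ = _ := one_mul _
  -- the centre brackets
  have hcen : padicNorm p ((if ¬ (2 : ℤ) ∣ b 0 ∧ ¬ CentreIn b p xb then 1 / ((b 0 : ℚ) / 2 - xb) else 0)
      + (if ¬ (2 : ℤ) ∣ b 0 ∧ ¬ CentreIn b p x then 1 / ((b 0 : ℚ) / 2 - x) else 0)) ≤ (p : ℚ) ^ (-(1 : ℤ)) := by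
    have hcc : CentreIn b p xb ↔ CentreIn b p x := centreIn_conj_iff b h0 hxN
    by_cases h : ¬ (2 : ℤ) ∣ b 0 ∧ ¬ CentreIn b p x
    · have h' : ¬ (2 : ℤ) ∣ b 0 ∧ ¬ CentreIn b p xb := ⟨h.1, fun hc => h.2 (hcc.1 hc)⟩
      rw [if_pos h', if_pos h]
      have h2Z : ¬ (p : ℤ) ∣ 2 := by
        intro hd; have := Int.le_of_dvd two_pos hd; have h5 := hp.out.two_le; omega
      have hn2 : padicNorm p (2 : ℚ) = 1 := by exact_mod_cast (padicNorm.int_eq_one_iff (p := p) 2).2 h2Z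
      have hA : ¬ (p : ℤ) ∣ (b 0 - 2 * x) := by
        intro hd; refine h.2 ?_; unfold CentreIn; have := dvd_neg.2 hd; rwa [neg_sub] at this
      have hB : ¬ (p : ℤ) ∣ (b 0 - 2 * xb) := by
        intro hd; refine h'.2 ?_; unfold CentreIn; have := dvd_neg.2 hd; rwa [neg_sub] at this
      have hAq : ((b 0 : ℚ) - 2 * x) ≠ 0 := by
        have : (b 0 - 2 * x : ℤ) ≠ 0 := fun h0' => hA (by rw [h0']; exact dvd_zero _)
        exact_mod_cast this
      have hBq : ((b 0 : ℚ) - 2 * xb) ≠ 0 := by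
        have : (b 0 - 2 * xb : ℤ) ≠ 0 := fun h0' => hB (by rw [h0']; exact dvd_zero _)
        exact_mod_cast this
      have e : 1 / ((b 0 : ℚ) / 2 - xb) + 1 / ((b 0 : ℚ) / 2 - x)
          = 2 * (2 * ((N : ℚ) - xb - x)) * (((b 0 - 2 * xb : ℤ) : ℚ))⁻¹ * (((b 0 - 2 * x : ℤ) : ℚ))⁻¹ := by
        have hb0q : ((N : ℕ) : ℚ) = (b 0 : ℚ) := by exact_mod_cast hb0
        push_cast
        rw [hb0q]
        field_simp
        ring
      rw [e]
      simp only [padicNorm.mul, padicNorm_inv_int_eq_one hA, padicNorm_inv_int_eq_one hB, hn2, one_mul, mul_one]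
      exact hDnorm
    · have h' : ¬ (¬ (2 : ℤ) ∣ b 0 ∧ ¬ CentreIn b p xb) := fun h'' => h ⟨h''.1, fun hc => h''.2 (hcc.2 hc)⟩
      rw [if_neg h', if_neg h, add_zero, padicNorm.zero]
      exact zpow_p_nonneg _
  -- assemble
  have e : phiHat b p xb + phiHat b p x
      = (∑ t ∈ Fx, ((netExp b t : ℚ) / (((N - t : ℕ) : ℚ) - xb) + (netExp b t : ℚ) / ((t : ℚ) - x)))
        + ((if ¬ (2 : ℤ) ∣ b 0 ∧ ¬ CentreIn b p xb then 1 / ((b 0 : ℚ) / 2 - xb) else 0)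
          + (if ¬ (2 : ℤ) ∣ b 0 ∧ ¬ CentreIn b p x then 1 / ((b 0 : ℚ) / 2 - x) else 0)) := by
    unfold phiHat
    rw [← hN, ← hFb, ← hFx, sum_add_distrib, ← hreidx]
    ring
  rw [e]
  exact (padicNorm.nonarchimedean (p := p)).trans (max_le (padicNorm.sum_le' hterm (zpow_p_nonneg _)) hcen)

/-! ## §2 The top level of the conjugate class -/

/-- `topLevel` is conjugation invariant on the residues `x < p ≤ b₀`. -/
theorem topLevel_conj (b : ℕ → ℤ) (hpn : p ≤ (b 0).toNat) {x : ℕ} (hx : x < p) :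
    topLevel b p (conjClass b p x) = topLevel b p x := by
  have hxn : x ≤ (b 0).toNat := by omega
  obtain ⟨hL, hL'⟩ := level_bounds' (p := p) b hxn
  have hcx := CellKit.conjClass_eq_level b hL hL'
  have h1 : conjClass b p x + topLevel b p x * p ≤ (b 0).toNat := by rw [hcx]; omega
  have h2 : (b 0).toNat < conjClass b p x + topLevel b p x * p + p := by rw [hcx]; omega
  exact topLevel_level b h1 h2


/-! ## §3 The deep-pair remainder of the origin-regime aggregation -/

section DeepPair

variable (b : ℕ → ℤ) (hb : InPolytope b) (hp5 : 5 ≤ p) (hpn : (p : ℤ) ≤ b 0) (hwin : (b 0 + 2 : ℤ) < (p : ℤ) ^ 2)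
  {M : ℕ} (hMe : Even M) {x : ℕ} (hxp : x < p) (hE : classExp b p x = -(M : ℤ)) (hc' : ¬ CentreIn b p x)
include hb hp5 hpn hwin hMe hxp hE hc'

/-- **Deep-pair remainder.**  For a pole class `x` of even exponent `−M` not containing the centre, with `x̄` its conjugate,
`c_z = ½ĝ_z(1 − ½pL_zφ_z)` and `F_z = ĝ_z(σ_z − pφ_zσ₂,z) + p(ĝφ)_z/4·P_z − c_z(σ_z − σ_z̄)` (`σ = ŵ` resp. `v̂`, `P` the doubled orbit
point), `‖F_x + F_x̄‖ ≤ p⁻²`: the exact identity `F_x + F_x̄ = ½ε(σ_x+σ_x̄) + ¼pδ(τ_x − τ_x̄ − L(σ_x+σ_x̄))` with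
`ε = ĝ_x + ĝ_x̄ − Lpφ_xĝ_x = O(p²)` (`gHat_pair_second`) and `δ = ĝ_x̄φ_x̄ − ĝ_xφ_x = O(p)` (`phiHat_conj_add`). -/
theorem deep_pair_remainder :
    padicNorm p
      ((gHat b p x * (wHat b p x - (p : ℚ) * phiHat b p x * wHat2 b p x)
          + (p : ℚ) * (gHat b p x * phiHat b p x / 4 * pointW b p M x)
          - gHat b p x * (1 - (topLevel b p x : ℚ) * p * phiHat b p x / 2) / 2 * (wHat b p x - wHat b p (conjClass b p x)))
        + (gHat b p (conjClass b p x) * (wHat b p (conjClass b p x)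
              - (p : ℚ) * phiHat b p (conjClass b p x) * wHat2 b p (conjClass b p x))
          + (p : ℚ) * (gHat b p (conjClass b p x) * phiHat b p (conjClass b p x) / 4 * pointW b p M (conjClass b p x))
          - gHat b p (conjClass b p x) * (1 - (topLevel b p (conjClass b p x) : ℚ) * p * phiHat b p (conjClass b p x) / 2) / 2
              * (wHat b p (conjClass b p x) - wHat b p (conjClass b p (conjClass b p x)))))
      ≤ (p : ℚ) ^ (-(2 : ℤ)) ∧
    padicNorm p
      ((gHat b p x * (vHat b p x - (p : ℚ) * phiHat b p x * vHat2 b p x)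
          + (p : ℚ) * (gHat b p x * phiHat b p x / 4 * pointV b p M x)
          - gHat b p x * (1 - (topLevel b p x : ℚ) * p * phiHat b p x / 2) / 2 * (vHat b p x - vHat b p (conjClass b p x)))
        + (gHat b p (conjClass b p x) * (vHat b p (conjClass b p x)
              - (p : ℚ) * phiHat b p (conjClass b p x) * vHat2 b p (conjClass b p x))
          + (p : ℚ) * (gHat b p (conjClass b p x) * phiHat b p (conjClass b p x) / 4 * pointV b p M (conjClass b p x))
          - gHat b p (conjClass b p x) * (1 - (topLevel b p (conjClass b p x) : ℚ) * p * phiHat b p (conjClass b p x) / 2) / 2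
              * (vHat b p (conjClass b p x) - vHat b p (conjClass b p (conjClass b p x)))))
      ≤ (p : ℚ) ^ (-(2 : ℤ)) := by
  have h0 : 0 ≤ b 0 := hb.1.1
  have hp2 : p ≠ 2 := by omega
  have hpQ : (p : ℚ) ≠ 0 := Nat.cast_ne_zero.2 hp.out.ne_zero
  obtain ⟨-, -, -, hn⟩ := thmA_data b hb hwin
  have hpn' : p ≤ (b 0).toNat := by omega
  have h2n : padicNorm p (2 : ℚ) = 1 := padicNorm_two hp2
  have h4n : padicNorm p (4 : ℚ) = 1 := by rw [show (4 : ℚ) = 2 * 2 by norm_num, padicNorm.mul, h2n, one_mul]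
  have hhalf : padicNorm p ((1 : ℚ) / 2) = 1 := by rw [padicNorm.div, padicNorm.one, h2n, div_one]
  have hquart : padicNorm p ((1 : ℚ) / 4) = 1 := by rw [padicNorm.div, padicNorm.one, h4n, div_one]
  have hpn1 : padicNorm p (p : ℚ) = (p : ℚ) ^ (-(1 : ℤ)) := padicNorm_p
  have hg1 : ∀ x, x < p → padicNorm p (gHat b p x) ≤ 1 := fun x hx =>
    LevelClass.padicNorm_gHat_le_one b hb hp5 hx
      (mem_filter.2 ⟨mem_range.2 (by have := le_b0_of_lt b hpn hx; omega), rfl⟩)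
  have hφ1 : ∀ x, padicNorm p (phiHat b p x) ≤ 1 := fun x => padicNorm_phiHat_le_one b hp2 x
  have hw1 : ∀ z, padicNorm p (wHat b p z) ≤ 1 := fun z => LevelClass.padicNorm_wHat_le_one b h0 hn hp2 z
  have hv1 : ∀ z, padicNorm p (vHat b p z) ≤ 1 := fun z => LevelClass.padicNorm_vHat_le_one b h0 hn hp2
  have hτ1 : ∀ z, padicNorm p (tauW b p z) ≤ 1 ∧ padicNorm p (tauV b p z) ≤ 1 := fun z => padicNorm_tau_le_one b h0 hn hp2 z
  have hL1 : ∀ z, padicNorm p ((topLevel b p z : ℕ) : ℚ) ≤ 1 := fun z => by simpa using padicNorm.of_nat (p := p) (topLevel b p z)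
  have hxn := le_b0_of_lt b hpn hxp
  obtain ⟨hL, hL'⟩ := level_bounds' (p := p) b hxn
  have hEb : classExp b p (conjClass b p x) = -(M : ℤ) := by rw [classExp_conj b h0 hxn]; exact hE
  -- names for the two long expressions
  set FWx := gHat b p x * (wHat b p x - (p : ℚ) * phiHat b p x * wHat2 b p x)
      + (p : ℚ) * (gHat b p x * phiHat b p x / 4 * pointW b p M x)
      - gHat b p x * (1 - (topLevel b p x : ℚ) * p * phiHat b p x / 2) / 2 * (wHat b p x - wHat b p (conjClass b p x)) with hFWx
  set FWxb := gHat b p (conjClass b p x) * (wHat b p (conjClass b p x)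
        - (p : ℚ) * phiHat b p (conjClass b p x) * wHat2 b p (conjClass b p x))
      + (p : ℚ) * (gHat b p (conjClass b p x) * phiHat b p (conjClass b p x) / 4 * pointW b p M (conjClass b p x))
      - gHat b p (conjClass b p x) * (1 - (topLevel b p (conjClass b p x) : ℚ) * p * phiHat b p (conjClass b p x) / 2) / 2
        * (wHat b p (conjClass b p x) - wHat b p (conjClass b p (conjClass b p x))) with hFWxb
  set FVx := gHat b p x * (vHat b p x - (p : ℚ) * phiHat b p x * vHat2 b p x)
      + (p : ℚ) * (gHat b p x * phiHat b p x / 4 * pointV b p M x)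
      - gHat b p x * (1 - (topLevel b p x : ℚ) * p * phiHat b p x / 2) / 2 * (vHat b p x - vHat b p (conjClass b p x)) with hFVx
  set FVxb := gHat b p (conjClass b p x) * (vHat b p (conjClass b p x)
        - (p : ℚ) * phiHat b p (conjClass b p x) * vHat2 b p (conjClass b p x))
      + (p : ℚ) * (gHat b p (conjClass b p x) * phiHat b p (conjClass b p x) / 4 * pointV b p M (conjClass b p x))
      - gHat b p (conjClass b p x) * (1 - (topLevel b p (conjClass b p x) : ℚ) * p * phiHat b p (conjClass b p x) / 2) / 2
        * (vHat b p (conjClass b p x) - vHat b p (conjClass b p (conjClass b p x))) with hFVxb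
  have heven : Even (classExp b p x) := by rw [hE]; obtain ⟨r, hr⟩ := hMe; exact ⟨-(r : ℤ), by omega⟩
  -- abbreviations
  set g := gHat b p x
  set gb := gHat b p (conjClass b p x)
  set φ := phiHat b p x
  set φb := phiHat b p (conjClass b p x)
  set L : ℚ := ((topLevel b p x : ℕ) : ℚ) with hLdef
  have hLb : ((topLevel b p (conjClass b p x) : ℕ) : ℚ) = L := by rw [topLevel_conj b hpn' hxp]
  have hcc : conjClass b p (conjClass b p x) = x := conjClass_conjClass b hxp hpn'
  -- the two small quantities
  have hε : padicNorm p (g + gb - L * p * φ * g) ≤ (p : ℚ) ^ (-(2 : ℤ)) := gHat_pair_second b hb hp5 hxp hL hL' hc' heven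
  have hsum1 : padicNorm p (g + gb) ≤ (p : ℚ) ^ (-(1 : ℤ)) := by
    have e : g + gb = (g + gb - L * p * φ * g) + L * p * φ * g := by ring
    rw [e]
    refine (padicNorm.nonarchimedean (p := p)).trans (max_le (hε.trans ?_) ?_)
    · exact zpow_le_zpow_right₀ (by exact_mod_cast hp.out.one_lt.le) (by norm_num)
    · rw [padicNorm.mul, padicNorm.mul, padicNorm.mul, hpn1]
      have e1 : padicNorm p L * (p : ℚ) ^ (-(1 : ℤ)) ≤ 1 * (p : ℚ) ^ (-(1 : ℤ)) :=
        mul_le_mul_of_nonneg_right (hL1 x) (zpow_p_nonneg _)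
      have e2 : padicNorm p L * (p : ℚ) ^ (-(1 : ℤ)) * padicNorm p φ ≤ 1 * (p : ℚ) ^ (-(1 : ℤ)) * 1 :=
        mul_le_mul e1 (hφ1 x) (padicNorm.nonneg _) (by positivity)
      have e3 : padicNorm p L * (p : ℚ) ^ (-(1 : ℤ)) * padicNorm p φ * padicNorm p g ≤ 1 * (p : ℚ) ^ (-(1 : ℤ)) * 1 * 1 :=
        mul_le_mul e2 (hg1 x hxp) (padicNorm.nonneg _) (by positivity)
      calc padicNorm p L * (p : ℚ) ^ (-(1 : ℤ)) * padicNorm p φ * padicNorm p g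
          ≤ 1 * (p : ℚ) ^ (-(1 : ℤ)) * 1 * 1 := e3
        _ = (p : ℚ) ^ (-(1 : ℤ)) := by ring
  have hφφ : padicNorm p (φb + φ) ≤ (p : ℚ) ^ (-(1 : ℤ)) := phiHat_conj_add b h0 hp2 hpn' hxp
  have hδ : padicNorm p (gb * φb - g * φ) ≤ (p : ℚ) ^ (-(1 : ℤ)) := by
    have e : gb * φb - g * φ = (g + gb) * φb - g * (φb + φ) := by ring
    rw [e]
    refine (padicNorm.sub (p := p)).trans (max_le ?_ ?_)
    · rw [padicNorm.mul]
      calc padicNorm p (g + gb) * padicNorm p φb ≤ (p : ℚ) ^ (-(1 : ℤ)) * 1 :=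
            mul_le_mul hsum1 (hφ1 _) (padicNorm.nonneg _) (zpow_p_nonneg _)
        _ = _ := mul_one _
    · rw [padicNorm.mul]
      calc padicNorm p g * padicNorm p (φb + φ) ≤ 1 * (p : ℚ) ^ (-(1 : ℤ)) :=
            mul_le_mul (hg1 x hxp) hφφ (padicNorm.nonneg _) zero_le_one
        _ = _ := one_mul _
  -- the exact identities behind the pairing
  have hPW : pointW b p M x = tauW b p x + tauW b p (conjClass b p x) := by
    unfold pointW; rw [if_pos hE]
  have hPWb : pointW b p M (conjClass b p x) = tauW b p (conjClass b p x) + tauW b p x := by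
    unfold pointW; rw [if_pos hEb, hcc]
  have hPV : pointV b p M x = tauV b p x + tauV b p (conjClass b p x) := by
    unfold pointV; rw [if_pos hE]
  have hPVb : pointV b p M (conjClass b p x) = tauV b p (conjClass b p x) + tauV b p x := by
    unfold pointV; rw [if_pos hEb, hcc]
  have keyW : FWx + FWxb
      = (1 : ℚ) / 2 * ((g + gb - L * p * φ * g) * (wHat b p x + wHat b p (conjClass b p x)))
        + (1 : ℚ) / 4 * ((p : ℚ) * ((gb * φb - g * φ)
            * (tauW b p x - tauW b p (conjClass b p x) - L * (wHat b p x + wHat b p (conjClass b p x))))) := by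
    simp only [hFWx, hFWxb, hcc, hPW, hPWb, hLb]
    unfold tauW
    rw [topLevel_conj b hpn' hxp]
    ring
  have keyV : FVx + FVxb
      = (1 : ℚ) / 2 * ((g + gb - L * p * φ * g) * (vHat b p x + vHat b p (conjClass b p x)))
        + (1 : ℚ) / 4 * ((p : ℚ) * ((gb * φb - g * φ)
            * (tauV b p x - tauV b p (conjClass b p x) - L * (vHat b p x + vHat b p (conjClass b p x))))) := by
    simp only [hFVx, hFVxb, hcc, hPV, hPVb, hLb]
    unfold tauV
    rw [topLevel_conj b hpn' hxp]
    ring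
  -- the bounds
  have bound : ∀ {u v w : ℚ}, padicNorm p u ≤ 1 → padicNorm p v ≤ 1 → padicNorm p w ≤ 1 →
      padicNorm p ((1 : ℚ) / 2 * ((g + gb - L * p * φ * g) * u) + (1 : ℚ) / 4 * ((p : ℚ) * ((gb * φb - g * φ) * (v - L * w))))
        ≤ (p : ℚ) ^ (-(2 : ℤ)) := by
    intro u v w hu hv hw
    refine (padicNorm.nonarchimedean (p := p)).trans (max_le ?_ ?_)
    · rw [padicNorm.mul, hhalf, one_mul, padicNorm.mul]
      calc _ ≤ (p : ℚ) ^ (-(2 : ℤ)) * 1 := mul_le_mul hε hu (padicNorm.nonneg _) (zpow_p_nonneg _)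
        _ = _ := mul_one _
    · have hvw : padicNorm p (v - L * w) ≤ 1 := by
        refine (padicNorm.sub (p := p)).trans (max_le hv ?_)
        rw [padicNorm.mul]
        calc _ ≤ (1 : ℚ) * 1 := mul_le_mul (hL1 x) hw (padicNorm.nonneg _) zero_le_one
          _ = 1 := one_mul _
      rw [padicNorm.mul, hquart, one_mul, padicNorm.mul, hpn1, padicNorm.mul]
      calc (p : ℚ) ^ (-(1 : ℤ)) * (padicNorm p (gb * φb - g * φ) * padicNorm p (v - L * w))
          ≤ (p : ℚ) ^ (-(1 : ℤ)) * ((p : ℚ) ^ (-(1 : ℤ)) * 1) :=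
            mul_le_mul_of_nonneg_left (mul_le_mul hδ hvw (padicNorm.nonneg _) (zpow_p_nonneg _)) (zpow_p_nonneg _)
        _ = (p : ℚ) ^ (-(2 : ℤ)) := by rw [mul_one, ← zpow_add₀ hpQ]; norm_num
  have huW : padicNorm p (wHat b p x + wHat b p (conjClass b p x)) ≤ 1 :=
    (padicNorm.nonarchimedean (p := p)).trans (max_le (hw1 _) (hw1 _))
  have huV : padicNorm p (vHat b p x + vHat b p (conjClass b p x)) ≤ 1 :=
    (padicNorm.nonarchimedean (p := p)).trans (max_le (hv1 _) (hv1 _))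
  have hτW : padicNorm p (tauW b p x - tauW b p (conjClass b p x)) ≤ 1 :=
    (padicNorm.sub (p := p)).trans (max_le (hτ1 _).1 (hτ1 _).1)
  have hτV : padicNorm p (tauV b p x - tauV b p (conjClass b p x)) ≤ 1 :=
    (padicNorm.sub (p := p)).trans (max_le (hτ1 _).2 (hτ1 _).2)
  constructor
  · rw [keyW]; exact bound huW hτW huW
  · rw [keyV]; exact bound huV hτV huV

end DeepPair

end Summit.KontsevichZagierPeriods.Zeta5Search.SecondOrder
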